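import Summits.QuantumFields.BalabanUV.Beta.NVertexColumnK1RowChartGeneric
import Summits.QuantumFields.BalabanUV.Beta.RelInvCompositeSym
import Summits.QuantumFields.BalabanUV.Beta.FP.CompositeOneShotJetDataSym

/-!
# `BalabanUV.Beta.NVertexColumnK1RowSym` — row D1 ∕ (C1): THE L-CHART INSTANCES — the displayed letters of the all-(0.4) presentation AS THEOREMS at `ANs R Ψ̂ˢ j`
# (road S-L1 `FP.CompositeOneShotJetDataSym.ANs` at `Ψ̂ˢ := fun m => CompositeCorrectorKernelSym.psiKSym R.rc Lc m`): `decays_ANs_sym` (`hA`), `colH_ANs_eq_…`,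
# `curvAdj_curv_colH_ANs` (`hE`, by PART 126 `curv_corrPsiSym`), `ANs_inr_inr_smul` (`hmm`), the (K1)∕(K1′) rows `K1_row_sym_column_{straight,sym}`, `LamNs_eq_neg_HΦcol`,
# `LamNs_eq_neg_ANs_inr_inr` (PART 22∕28 at the L-chart, NO displayed letter), and the SOCKET ROW `relInv_ANs_sym` (XREAD-L §0's `relInv_ANs` with its six corrector letters
# discharged by `CompositeCorrectorKernelSym`∕`RulesSym`; in `RelInvCompositeSym.bhKcompSym`'s name: `relInv_ANs_sym'`).

WHAT ([folklore] bookkeeping; no `def`; nothing cited; 0 sorry).  Depends on road S-L1 (the object `ANs`) — the one row file under (b) with a road prerequisite.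

HONEST FRAMING (cell charter, verbatim): «discharging BetaPertH makes Balaban's UV stability UNCONDITIONAL — a real
constructive-QFT result; it is NOT the continuum limit and NOT the Clay problem.»
HONEST DEPENDENCY: continuum YM on T⁴ ⇐ BetaPertH ∧ nine spine estimates (0/9 proved); BetaPertH ⇐ (D1) ∧ (D4) ∧ CAP+tail;
G-an2-4 gates asym, D1 and NE2/3/4.
ABSOLUTE RULE (cell, verbatim): «No internally-minted statement may enter as a cited fact. Every hypothesis is either kernel-proved in this
package or a verbatim quotation of a PUBLISHED theorem with page reference. The manuscript(s) under audit are NOT citable for their own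
disputed steps — they are the thing under adjudication; programme-internal (2001/route/tribunal) claims are never citable.»
Row D1 ∕ (C1) OWNER an2 (b2b-balaban-beta-an2) gen 92, 2026-08-31.  No existing file touched.  STAGED ONLY (FILING PLAN FP-L F-L7b); NOT proposed before the operator∕director line.
NOTHING of Bałaban's asserted, valued or discharged; 0 estimates; 0∕4 row-D1 binders; ROOT M‴ p325680 ∕ P5c ∕ D6 untouched; NOT (C1), NOT (T-ID), NOT D1, NEVER «G-an2-4 closed», NOT BetaPertH, NOT continuum, NOT Clay.
-/

namespace Summit.QuantumFields.BalabanUV.Beta.NVertexColumnK1RowSym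

open Finset
open Literature.MathematicalPhysics.QuantumFieldTheory
open Literature.MathematicalPhysics.QuantumFieldTheory.Balaban1983to89
open Literature.MathematicalPhysics.QuantumFieldTheory.Balaban1983to89.Beta
open B12Sec2to5 (l1 l1_nonneg summable_exp_neg_l1)
open AffineAveraging (Form1 Site box toSite curv curvAdj codiff₁)
open AveragingHessianKernels (Bond Near ell straightCount)
open ExpKernelCalculus (MKer Decays comp)
open OneStepResolventKernel (Fib KInv KInv_inr_inr_coarse decays_KInv)
open OneStepKernelFamily (colH)
open KernelSpecInstance (wΦ)
open ResolventComposition (Hcol HΦcol HΦcol_apply Hcol_bdd_summable)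
open BalabanStepJets (lamCoeffOf)
open KKTFluctuationEnergy (lip1 summable_of_exp_bound summable_mul_of_bdd abs_le_of_exp_bound)
open Summit.QuantumFields.BalabanUV.Beta.TameKernelCalculus (Spr trK Spr.trK)
open Summit.QuantumFields.BalabanUV.Beta.ChartConjugationRelative (spr_comp)
open Summit.QuantumFields.BalabanUV.Beta.AxialDressingRooted (coProjBmW coDressKBmAt coDressKBmAt_inr_inr spr_coDressKBmAt one_le_of_neZero)
open Summit.QuantumFields.BalabanUV.Beta.SymAveragingHessianCounts (symLinKerAt symLinKerAt_eq_zero)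
open Summit.QuantumFields.BalabanUV.Beta.CompositeVertexKernelRec (compLinKer)
open Summit.QuantumFields.BalabanUV.Beta.NVertexLamWeightLadder (compLinKer_succ_bottom lamR_succ)
open Summit.QuantumFields.BalabanUV.Beta.CompositeCorrectorForms (corrPsi curv_corrPsi)
open Summit.QuantumFields.BalabanUV.Beta.CompositeAveragingCoarseExactGeneric (corrPsiSym curv_corrPsiSym)
open Summit.QuantumFields.BalabanUV.Beta.CompositeCorrectorKernel (psiK)
open Summit.QuantumFields.BalabanUV.Beta.CompositeOneShotJetData (Roots AN AN_eq)
open Summit.QuantumFields.BalabanUV.Beta.NVertexSectors (decays_AN)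
open Summit.QuantumFields.BalabanUV.Beta.StraightColumnK1Row (lamCovector_eq_neg_lip1_curvAdj lamCovector_Hcol K1_row_straight_column_straight codiff₁_lamCovector)
open Summit.QuantumFields.BalabanUV.Beta.BlockMeanChartK1Row (coProjBmW_Hcol_eq_colH_coDressKBmAt curvAdj_curv_coProjBmW)
open Summit.QuantumFields.BalabanUV.Beta.CoclosedCovectorLinearRowsNear (summable_of_near straightCount_eq_zero_of_not_near)
open Summit.QuantumFields.BalabanUV.Beta.GAN24.TaylorLamBracket (exists_abs_lamCoeffOf_KInv_le)
open Summit.QuantumFields.BalabanUV.Beta.CoclosedCovectorCompositeRows (tsum_sum_mul_compLinKer_symLinKerAt_of_bounded)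
open Summit.QuantumFields.BalabanUV.Beta.NVertexLamCorePeriodised (slot_mem_nearBox_of_near)
open Summit.QuantumFields.BalabanUV.Beta.NVertexColumnK1Row (curvAdj_curv_colH_AN K1_row_composite_column_sym LamN_eq_neg_HΦcol)
open Summit.QuantumFields.BalabanUV.Beta.NVertexLamK1Prime (AN_inr_inr_smul LamN_eq_neg_AN_inr_inr)
open HessKerSchurResolvent (idK)
open Summit.QuantumFields.BalabanUV.Beta.ChartConjugationRelative (RelInv)
open Summit.QuantumFields.BalabanUV.Beta.AxialDressingRooted (axEc)
open Summit.QuantumFields.BalabanUV.Beta.BorderedHessian (bhK)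
open Summit.QuantumFields.BalabanUV.Beta.RelInvCompositeSocket (relInv_composite_of_corrector)
open Summit.QuantumFields.BalabanUV.Beta.RelInvComposite (bhKcomp relInv_composite)
open Summit.QuantumFields.BalabanUV.Beta.CompositeCorrectorKernelSym (psiKSym phiKSym spr_psiKSym spr_phiKSym comp_psiKSym_inl comp_psiKSym_inr comp_trK_psiKSym_inr)
open Summit.QuantumFields.BalabanUV.Beta.CompositeCorrectorRulesSym (comp_psiKSym_phiKSym comp_phiKSym_psiKSym comp_comp_axEc_psiKSym comp_comp_axEc_phiKSym)
open Summit.QuantumFields.BalabanUV.Beta.RelInvCompositeSym (bhKcompSym bhKcompSym_eq)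
open Summit.QuantumFields.BalabanUV.Beta.FP.CompositeOneShotJetDataSym (ANs ANs_psiK)
open Summit.QuantumFields.BalabanUV.Beta.NVertexColumnK1RowChartGeneric

noncomputable section

variable {Lc : ℕ} [NeZero Lc] (R : Roots Lc) (j : ℕ)

/-! ## §1 The three chart letters + (K1)∕(K1′) AT THE L-CHART `ANs R Ψ̂ˢ j` — NO displayed letter -/

section Sym

/-- [folklore] **`hA` AT THE (0.4) CHART**: `ANs R Ψ̂ˢ j` decays (`spr_psiKSym`, `spr_coDressKBmAt`, `spr_comp`, `Spr.trK` — `decays_compChart`'s proof at `psiKSym`). -/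
theorem decays_ANs_sym : ∃ δ C : ℝ, 0 < δ ∧ 0 ≤ C ∧ Decays (ANs R (fun m => psiKSym R.rc Lc m) j) C δ := by
  have hKs : Spr (KInv (N := Lc ^ (j + 1)) (d := 3)) := by
    obtain ⟨δ, C, hδ, -, h⟩ := decays_KInv (N := Lc ^ (j + 1)) (d := 3)
    exact ⟨C, δ, hδ, h⟩
  have hΨ := spr_psiKSym (Nat.pos_of_ne_zero (NeZero.ne Lc)) R.hrc (j + 1)
  obtain ⟨C, δ, hδ, h⟩ := spr_comp (spr_comp hΨ (spr_coDressKBmAt (one_le_of_neZero (Lc ^ (j + 1))) (R.hs (j + 1)) hKs)) hΨ.trK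
  exact ⟨δ, C, hδ, h.nonneg (Sum.inl 0), h⟩

/-- [folklore] **THE (0.4)-CHART's COLUMN IS `Ψˢ_{j+1}` OF THE CO-DRESSED STRAIGHT COLUMN** (XREAD-RS's apply bridges `comp_trK_psiKSym_inr`, `comp_psiKSym_inl`). -/
theorem colH_ANs_eq_corrPsiSym_colH_coDress (μ : Fin (3 + 1)) (y : Site (3 + 1)) :
    colH (ANs R (fun m => psiKSym R.rc Lc m) j) (Lc ^ (j + 1)) μ y
      = corrPsiSym R.rc Lc (j + 1) (colH (coDressKBmAt (toSite (R.s (j + 1))) (Lc ^ (j + 1)) (KInv (N := Lc ^ (j + 1)) (d := 3))) (Lc ^ (j + 1)) μ y) := by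
  have hL : 0 < Lc := Nat.pos_of_ne_zero (NeZero.ne Lc)
  funext κ' u
  rw [colH, ANs, comp_trK_psiKSym_inr, comp_psiKSym_inl hL R.hrc (j + 1)]
  rfl

/-- [folklore] `colH (ANs R Ψ̂ˢ j) L μ y = Ψˢ_{j+1} (Π_bm ℋ_L(·; μ, y))`. -/
theorem colH_ANs_eq_corrPsiSym_coProjBmW_Hcol (μ : Fin (3 + 1)) (y : Site (3 + 1)) :
    colH (ANs R (fun m => psiKSym R.rc Lc m) j) (Lc ^ (j + 1)) μ y
      = corrPsiSym R.rc Lc (j + 1) (coProjBmW (toSite (R.s (j + 1))) (Lc ^ (j + 1)) (Hcol (N := Lc ^ (j + 1)) μ y)) := by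
  rw [colH_ANs_eq_corrPsiSym_colH_coDress, coProjBmW_Hcol_eq_colH_coDressKBmAt]

/-- [folklore] **`hE` AT THE (0.4) CHART**: `E″ (colH (ANs R Ψ̂ˢ j) L μ y) = E″ ℋ_L(·; μ, y)` (PART 126 `curv_corrPsiSym`: `Ψˢ − 1` is a fine pure gauge; g60 `curvAdj_curv_coProjBmW`). -/
theorem curvAdj_curv_colH_ANs (μ : Fin (3 + 1)) (y : Site (3 + 1)) :
    curvAdj (curv (colH (ANs R (fun m => psiKSym R.rc Lc m) j) (Lc ^ (j + 1)) μ y)) = curvAdj (curv (Hcol (N := Lc ^ (j + 1)) μ y)) := by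
  rw [colH_ANs_eq_corrPsiSym_coProjBmW_Hcol, curv_corrPsiSym, curvAdj_curv_coProjBmW (one_le_of_neZero _) (R.hs (j + 1))]

/-- [folklore] **`hmm` AT THE (0.4) CHART**: the multiplier–multiplier block of `ANs R Ψ̂ˢ j` at coarse points is the straight `wΦ` (`Ψ̂ˢ`, `Π_bm` fix multiplier indices). -/
theorem ANs_inr_inr_smul (ν μ : Fin (3 + 1)) (w y : Site (3 + 1)) :
    ANs R (fun m => psiKSym R.rc Lc m) j (((Lc ^ (j + 1) : ℕ) : ℤ) • w) (((Lc ^ (j + 1) : ℕ) : ℤ) • y) (Sum.inr ν) (Sum.inr μ)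
      = wΦ (N := Lc ^ (j + 1)) ν μ (w - y) := by
  unfold Summit.QuantumFields.BalabanUV.Beta.FP.CompositeOneShotJetDataSym.ANs
  rw [comp_trK_psiKSym_inr, comp_psiKSym_inr, coDressKBmAt_inr_inr, KInv_inr_inr_coarse]

/-- [folklore] **`LamNs_eq_neg_HΦcol` — AT THE (0.4) CHART THE CONTRACTED MULTIPLIER RESPONSE IS MINUS THE STRAIGHT COLUMN's OWN MULTIPLIER**, every depth, NO displayed letter. -/
theorem LamNs_eq_neg_HΦcol (μ ν : Fin (3 + 1)) (y w : Site (3 + 1)) :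
    (∑ κ' : Fin (3 + 1), ∑' u : Site (3 + 1),
        ANs R (fun m => psiKSym R.rc Lc m) j u (((Lc ^ (j + 1) : ℕ) : ℤ) • y) (Sum.inl κ') (Sum.inr μ)
          * lamCoeffOf (KInv (N := Lc ^ (j + 1)) (d := 3)) (Lc ^ (j + 1)) ν w κ' u)
      = -HΦcol (N := Lc ^ (j + 1)) μ y ν w :=
  LamA_eq_neg_HΦcol j _ (decays_ANs_sym R j) (curvAdj_curv_colH_ANs R j) μ ν y w

/-- [folklore] **(K1) FOR THE (0.4)-CHART COLUMN, STRAIGHT ROWS** — NO displayed letter. -/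
theorem K1_row_sym_column_straight (μ : Fin (3 + 1)) (y : Site (3 + 1)) (f : Bond (3 + 1)) :
    curvAdj (curv (colH (ANs R (fun m => psiKSym R.rc Lc m) j) (Lc ^ (j + 1)) μ y)) f.1 f.2
      = -∑' w : Site (3 + 1), ∑ ν : Fin (3 + 1),
          (∑ κ' : Fin (3 + 1), ∑' u : Site (3 + 1),
              ANs R (fun m => psiKSym R.rc Lc m) j u (((Lc ^ (j + 1) : ℕ) : ℤ) • y) (Sum.inl κ') (Sum.inr μ)
                * lamCoeffOf (KInv (N := Lc ^ (j + 1)) (d := 3)) (Lc ^ (j + 1)) ν w κ' u)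
            * (straightCount (Lc ^ (j + 1)) ν w f : ℝ) :=
  K1_row_A_column_straight j _ (decays_ANs_sym R j) (curvAdj_curv_colH_ANs R j) μ y f

/-- [folklore] **(K1) FOR THE (0.4)-CHART COLUMN WITH THE FULLY TRANSPORTED WEIGHT, (0.4)-SYMMETRISED ROWS, EVERY DEPTH** (`α = −(Lc⁴)^{j+1}`) — NO displayed letter:
the END wrapper's finest-level (K1) SHAPE for the L-chart's column on `ℤ⁴`. -/
theorem K1_row_sym_column_sym (μ : Fin (3 + 1)) (y : Site (3 + 1)) (f : Bond (3 + 1)) :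
    curvAdj (curv (colH (ANs R (fun m => psiKSym R.rc Lc m) j) (Lc ^ (j + 1)) μ y)) f.1 f.2
      = -((Lc : ℝ) ^ (3 + 1)) ^ (j + 1) * ∑ κ₁ : Fin (3 + 1), ∑' s₁ : Site (3 + 1),
          (∑ ν : Fin (3 + 1), ∑' w : Site (3 + 1),
              (∑ κ' : Fin (3 + 1), ∑' u : Site (3 + 1),
                  ANs R (fun m => psiKSym R.rc Lc m) j u (((Lc ^ (j + 1) : ℕ) : ℤ) • y) (Sum.inl κ') (Sum.inr μ)
                    * lamCoeffOf (KInv (N := Lc ^ (j + 1)) (d := 3)) (Lc ^ (j + 1)) ν w κ' u)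
                * compLinKer (fun _ => symLinKerAt (toSite R.r) Lc) Lc j (κ₁, s₁) (ν, w))
            * symLinKerAt (toSite R.r) Lc κ₁ s₁ f :=
  K1_row_A_column_sym R j _ (decays_ANs_sym R j) (curvAdj_curv_colH_ANs R j) μ y f

/-- [folklore] **(K1′) AT THE (0.4) CHART, EVERY DEPTH, `κ₁ = −1`** — NO displayed letter:
`Σ_{κ′} Σ'_u (ANs R Ψ̂ˢ j) u (L•y) (inl κ′) (inr μ) · lamCoeffOf (KInv L) L ν w κ′ u = −(ANs R Ψ̂ˢ j) (L•w) (L•y) (inr ν) (inr μ)`. -/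
theorem LamNs_eq_neg_ANs_inr_inr (μ ν : Fin (3 + 1)) (y w : Site (3 + 1)) :
    (∑ κ' : Fin (3 + 1), ∑' u : Site (3 + 1),
        ANs R (fun m => psiKSym R.rc Lc m) j u (((Lc ^ (j + 1) : ℕ) : ℤ) • y) (Sum.inl κ') (Sum.inr μ)
          * lamCoeffOf (KInv (N := Lc ^ (j + 1)) (d := 3)) (Lc ^ (j + 1)) ν w κ' u)
      = -ANs R (fun m => psiKSym R.rc Lc m) j (((Lc ^ (j + 1) : ℕ) : ℤ) • w) (((Lc ^ (j + 1) : ℕ) : ℤ) • y) (Sum.inr ν) (Sum.inr μ) :=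
  LamA_eq_neg_A_inr_inr j _ (decays_ANs_sym R j) (curvAdj_curv_colH_ANs R j) (ANs_inr_inr_smul R j) μ ν y w

end Sym

/-! ## §2 The SOCKET ROW at the L-chart: XREAD-L §0 `relInv_ANs` with its six corrector letters DISCHARGED -/

section Junction

/-- [folklore] **`relInv_ANs_sym` — XREAD-L's SOCKET ROW AT THE (0.4)-COMPOSITE CORRECTOR PAIR WITH NO DISPLAYED LETTER.**  For every root datum `R : Roots Lc` and every door
index `j`: `RelInv (ANs R Ψ̂ˢ j) (Φ̂ˢ_{j+1}ᵀ ∘ bhK (Lc^(j+1)) ∘ Φ̂ˢ_{j+1}) (axEc (toSite (R.s (j+1))) (Lc^(j+1)))`, `Ψ̂ˢ_m := psiKSym R.rc Lc m`, `Φ̂ˢ_m := phiKSym R.rc Lc m` —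
XREAD-L v1.4 §0 `relInv_ANs`'s conclusion, its letters `hΨ hΦ hΨΦ hΦΨ hEΨ hEΦ` being §2–§4's theorems at `(L, r, m, s) := (Lc, R.rc, j+1, R.s (j+1))` (memberships = `Roots`' fields
`R.hrc`, `R.hs`; `0 < Lc` from `[NeZero Lc]`).  What this is NOT: the identification of `Φ̂ˢᵀ∘bhK∘Φ̂ˢ` with the literal's (0.4)-bordered composite Hessian ((L-k4), K-U3d-sym — absent). -/
theorem relInv_ANs_sym (j : ℕ) :
    RelInv (ANs R (fun m => psiKSym R.rc Lc m) j)
      (comp (comp (trK (phiKSym R.rc Lc (j + 1))) (bhK (Lc ^ (j + 1)))) (phiKSym R.rc Lc (j + 1)))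
      (axEc (toSite (R.s (j + 1))) (Lc ^ (j + 1))) :=
  relInv_composite_of_corrector (N := Lc ^ (j + 1)) (d := 3) (R.hs (j + 1))
    (spr_psiKSym (Nat.pos_of_ne_zero (NeZero.ne Lc)) R.hrc (j + 1)) (spr_phiKSym (Nat.pos_of_ne_zero (NeZero.ne Lc)) R.hrc (j + 1))
    (comp_psiKSym_phiKSym (Nat.pos_of_ne_zero (NeZero.ne Lc)) R.rc R.hrc (j + 1))
    (comp_phiKSym_psiKSym (Nat.pos_of_ne_zero (NeZero.ne Lc)) R.rc R.hrc (j + 1))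
    (comp_comp_axEc_psiKSym R.rc Lc (j + 1) (R.hs (j + 1))) (comp_comp_axEc_phiKSym R.rc Lc (j + 1) (R.hs (j + 1)))

/-- [folklore] The same END in `bhKcompSym`'s name: `RelInv (ANs R Ψ̂ˢ j) (bhKcompSym R.rc Lc (j+1)) (axEc …)`. -/
theorem relInv_ANs_sym' (j : ℕ) :
    RelInv (ANs R (fun m => psiKSym R.rc Lc m) j) (bhKcompSym R.rc Lc (j + 1)) (axEc (toSite (R.s (j + 1))) (Lc ^ (j + 1))) :=
  relInv_ANs_sym R j

/-- (II) CONTROL [folklore]: the ROOTED chart's row — `RelInv (AN R j) (bhKcomp R.rc Lc (j+1)) (axEc …)` — is the tree's `RelInvComposite.relInv_composite`. -/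
example (j : ℕ) : RelInv (AN R j) (bhKcomp R.rc Lc (j + 1)) (axEc (toSite (R.s (j + 1))) (Lc ^ (j + 1))) :=
  relInv_composite (Nat.pos_of_ne_zero (NeZero.ne Lc)) R.rc R.hrc (R.hs (j + 1))

end Junction

end

end Summit.QuantumFields.BalabanUV.Beta.NVertexColumnK1RowSym
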